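import Summits.QuantumFields.BalabanUV.T4Continuum.Support.NE9ChannelReadingOfRecord

/-!
# NE9ChannelReadingSharp — route R4's docked (B2) constant WITHOUT the `√2`: the complexified channel reading of a one-step slice
# has operator norm `≤ τ m j` (not `√2·τ m j`), hence `‖RdOf (j+n) j s‖, ‖RdAmb (j+n) j s‖ ≤ τ̄·ωⁿ` — K2♭'s `hRd` with `τ₀ := τ̄`

Cell `pub-balaban`, T4-DAG §6 NE9; NE9 crux team (coordinator ruling «YM REDIRECT» e34b3e0c (2)), leaf lineage
`b2b-balaban-t4-ne9-formalise-leaf-05` generation 46; route R4 «fading by Earle–Hamilton» of `t4/ROUTES-NE9.md`; the refuter's located,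
removable SURCHARGE **F-R4-3** of `PRICING-NE9.md` v6 (journal l.28568): the owner's docking files `NE9ChannelRealLinear` (p252383) and
`NE9ChannelReadingOfRecord` (p253328) bound the complexified reading parts-wise (`Complex.norm_le_sqrt_two_mul_max`), which costs a
factor `√2` in binder (B2)'s constant (`τ₀ := √2·τ̄`) and hence in the route's quantitative window (θ_dock(S) = θ(S∕√2)); the refuter
observed — and kernel-checked the trigonometric half in scratch — that the `√2` is NOT load-bearing.  THIS FILE proves it on the
owner's OWN data (`rdFun`, `Rd`, `RdOf`, `RdAmb` — no new definition): every ROTATED real part `cos φ•H₁ + sin φ•H₂` of an admissible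
complex pair is again an admissible real family with the SAME decay-weighted profile (Cauchy–Schwarz in ℝ²), the channel is ℝ-linear on
one-step slices (`NE9ChannelRealLinear.channel_add` ∕ `channel_smul_atStep`), so the END of record's per-step size binder
`ChannelSizeAtStepNN` bounds EVERY rotated real part `cos φ·T H₁ y + sin φ·T H₂ y` of the complex output by `wt·τ·N`; a complex number all
of whose rotated real parts are `≤ M` has modulus `≤ M` (§1).  Hence `‖rdFun … G y‖ ≤ τ m j·‖G‖`, `‖Rd m j s‖ ≤ τ m j`, and the geometric
forms with `τ̄·ωⁿ`.

HONEST FRAMING (T4-DAG PAGE 1).  Rung (B)+1 of the FINITE-VOLUME T⁴ programme — NOT infinite volume, NOT a mass gap, NOT the Clay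
problem.  NE9 (`T4OutputRate.NE9` ∧ `FadingMemory`) is a cell NEW ESTIMATE, NOT PRINTED in [I] = [Balaban1987RG1] (CMP **109**), [II] =
[Balaban1988RG2Cluster] (CMP **116**), and NOT PROVED for Bałaban's E^{(j)} («NE9 ⇐ the named binders»; row WALLED ON A MODEL O-NE9-1;
spine PROVED 0∕9).  HONEST DEPENDENCY (cell line, verbatim): continuum YM on T⁴ ⇐ BetaPertH ∧ nine spine estimates (0/9 proved);
BetaPertH ⇐ (D1) ∧ (D4) ∧ CAP+tail; G-an2-4 gates asym, D1 and NE2/3/4.  `FlowStep.BetaPertH`, (B), (B^μ) do not occur.  Elementary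
trigonometry and operator-norm bookkeeping over the BINDER SHAPES of `T4HistoryLipschitzRecursion`; no `def`, no Prop-valued definition,
no estimate of any object of the series; [II] is referred to for TYPES only (ABSOLUTE RULE).  0 sorry.

* §1 [folklore] `abs_cos_mul_add_sin_mul_le` (Cauchy–Schwarz in ℝ²), **`norm_mk_le_of_forall_rotation`** (all rotated real parts `≤ M`
  ⇒ modulus `≤ M`; the refuter's scratch lemma `norm_mk_le_of_forall_rot`, re-proved here).
* §2 `rot_mem`, `rot_supported`, `abs_rot_apply_le`, `channel_rotate_atStep`, **`norm_channel_complex_le_atStep_of_complexBound_sharp`**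
  (`‖(T k s H₁ y, T k s H₂ y)‖_ℂ ≤ wt k y·(τ k j·N)` from the complex-modulus profile — p252383's `…_of_complexBound` without `√2`).
* §3 **`norm_rdFun_apply_le_sharp`** (`‖rdFun κ T wt m j s G y‖ ≤ τ m j·‖G‖`).
* §4 **`norm_Rd_le_sharp`** (`‖Rd m j s‖ ≤ τ m j`), `norm_RdOf_le_sharp`, **`norm_RdOf_le_geometric_sharp`** and
  **`norm_RdAmb_le_geometric_sharp`** (`≤ τ̄·ωⁿ` — K2♭'s `hRd` with `τ₀ := τ̄`).
* §5 `example`s: the parts-wise `√2` of `norm_mk_le_sqrt_two_mul` IS attained (`a = b = 1`), so only the complex-modulus-profile form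
  improves — which is the form the slice space of record feeds (`NE9SliceSpaceOfRecord.norm_mk_reF_imF_le`).
DISGUISE TEST: one channel, one slice, trigonometry and operator norms — no history, no two couplings, no renormalised term; not NE9.
WHAT THIS DOES NOT DO: it touches no activity, no species, no estimate of Bałaban's; the closure hypotheses `hsub`∕`hsmul` stay DISPLAYED
(discharged by inspection at each class of record, as in p252383); the docking itself (D3, owner: `NE9FutureProfileRecordPrelim` ∕
`NE9FutureProfileEndOfRecord`) is the owner's — there the constant is `JRec`'s `τ₀` (`injRead RdAmb` with `hRd := norm_RdAmb_le_geometric`)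
and it surfaces in the END's displayed ROOM `ω̂·r + τ₀·B₀ ≤ θ·r`; with §4 below `τ₀ := τ̄` is available for that slot
(`hRd := norm_RdAmb_le_geometric_sharp`), nothing else in D3 changes.

References (TYPES only): [Balaban1988RG2Cluster] T. Bałaban, Renormalization group approach to lattice gauge field theories. II. Cluster
expansions, Commun. Math. Phys. **116** (1988) 1–22 — (1.23) p. 7, p. 8 l. 9–10, (1.33) and (1.36) p. 9.  Summits-side NEW work (LEAN
PLACEMENT RULE); imports the owner's `NE9ChannelReadingOfRecord` BY NAME; modifies nothing; 0 sorry.  Value = route R4's binder (B2)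
constant restored to the undocked `τ̄` (the refuter's F-R4-3 surcharge removed in kernel), NOT summit progress.
-/

noncomputable section

namespace Summit.QuantumFields.BalabanUV.T4Continuum.NE9ChannelReadingSharp

open scoped ENNReal
open Literature.MathematicalPhysics.QuantumFieldTheory.Balaban1983to89
open Literature.MathematicalPhysics.QuantumFieldTheory.Balaban1983to89.T4OutputRate
open Literature.MathematicalPhysics.QuantumFieldTheory.Balaban1983to89.T4HistoryLipschitzRecursion
open Summit.QuantumFields.BalabanUV.T4Continuum.NE9ChannelRealLinear
open Summit.QuantumFields.BalabanUV.T4Continuum.NE9SliceSpaceOfRecord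
open Summit.QuantumFields.BalabanUV.T4Continuum.NE9ChannelReadingOfRecord

/-! ## §1 Rotations in the plane -/

/-- [folklore] **CAUCHY–SCHWARZ IN ℝ² ALONG A UNIT VECTOR**: `|cos φ·u + sin φ·v| ≤ ‖(u, v)‖_ℂ`. -/
theorem abs_cos_mul_add_sin_mul_le (φ u v : ℝ) : |Real.cos φ * u + Real.sin φ * v| ≤ ‖(⟨u, v⟩ : ℂ)‖ := by
  have h1 : Real.cos φ ^ 2 + Real.sin φ ^ 2 = 1 := Real.cos_sq_add_sin_sq φ
  have hsq : ‖(⟨u, v⟩ : ℂ)‖ ^ 2 = u * u + v * v := by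
    rw [← Complex.normSq_eq_norm_sq]; simp [Complex.normSq_apply]
  have hnn : 0 ≤ ‖(⟨u, v⟩ : ℂ)‖ := norm_nonneg _
  have key : (Real.cos φ * u + Real.sin φ * v) ^ 2 ≤ ‖(⟨u, v⟩ : ℂ)‖ ^ 2 := by
    rw [hsq]
    nlinarith [sq_nonneg (Real.cos φ * v - Real.sin φ * u), h1]
  exact abs_le_of_sq_le_sq' key hnn |>.elim (fun h h' => abs_le.mpr ⟨h, h'⟩)

/-- [folklore] **A COMPLEX NUMBER ALL OF WHOSE ROTATED REAL PARTS ARE `≤ M` HAS MODULUS `≤ M`**: `(∀ φ, a·cos φ + b·sin φ ≤ M) →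
‖a + bi‖ ≤ M` (take `φ := arg (a + bi)`).  This is the refuter's scratch lemma `norm_mk_le_of_forall_rot` (PRICING-NE9 v6 F-R4-3),
re-proved. -/
theorem norm_mk_le_of_forall_rotation {a b M : ℝ} (h : ∀ φ : ℝ, a * Real.cos φ + b * Real.sin φ ≤ M) :
    ‖(⟨a, b⟩ : ℂ)‖ ≤ M := by
  set z : ℂ := ⟨a, b⟩ with hz
  by_cases h0 : z = 0
  · have ha : a = 0 := by simpa [hz] using congrArg Complex.re h0
    have hM : a ≤ M := by simpa using h 0
    rw [h0, norm_zero]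
    linarith
  · have hpos : 0 < ‖z‖ := norm_pos_iff.mpr h0
    have key := h (Complex.arg z)
    rw [Complex.cos_arg h0, Complex.sin_arg z] at key
    have hre : z.re = a := rfl
    have him : z.im = b := rfl
    rw [hre, him] at key
    have hsq : ‖z‖ ^ 2 = a * a + b * b := by
      rw [← Complex.normSq_eq_norm_sq]; simp [Complex.normSq_apply, hz]
    have hid : a * (a / ‖z‖) + b * (b / ‖z‖) = ‖z‖ := by
      have hne : ‖z‖ ≠ 0 := ne_of_gt hpos
      field_simp
      nlinarith [hsq]
    linarith [key, hid]

/-! ## §2 The rotated real family and the `√2`-free per-slice bound of the complexified channel -/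

section Channel

variable {C : Carriers} {Bg ι : Type} {Adm : Set (Bg → C.Dom → ℝ)}
  {T : ℕ → (ℕ → ℝ) → (Bg → C.Dom → ℝ) → ι → ℝ} {κ : ℝ} {wt : ℕ → ι → ℝ} {τ : ℕ → ℕ → ℝ}

/-- [folklore] The rotated real family `cos φ•H₁ + sin φ•H₂` of an admissible pair is admissible (class closed under differences and
real scalars). -/
theorem rot_mem (hsub : ∀ H₁ ∈ Adm, ∀ H₂ ∈ Adm, H₁ - H₂ ∈ Adm) (hsmul : ∀ (c : ℝ), ∀ H ∈ Adm, c • H ∈ Adm)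
    {H₁ H₂ : Bg → C.Dom → ℝ} (h₁ : H₁ ∈ Adm) (h₂ : H₂ ∈ Adm) (φ : ℝ) :
    Real.cos φ • H₁ + Real.sin φ • H₂ ∈ Adm :=
  add_mem_of_closed hsub hsmul (hsmul _ H₁ h₁) (hsmul _ H₂ h₂)

/-- [folklore] The rotated real family of a pair supported at the creation step `j` is supported there. -/
theorem rot_supported {H₁ H₂ : Bg → C.Dom → ℝ} {j : ℕ}
    (hsupp₁ : ∀ (U : Bg) (X : C.Dom), C.scale X ≠ j → H₁ U X = 0)
    (hsupp₂ : ∀ (U : Bg) (X : C.Dom), C.scale X ≠ j → H₂ U X = 0) (φ : ℝ) :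
    ∀ (U : Bg) (X : C.Dom), C.scale X ≠ j → (Real.cos φ • H₁ + Real.sin φ • H₂) U X = 0 := fun U X hX => by
  simp only [Pi.add_apply, Pi.smul_apply, smul_eq_mul, hsupp₁ U X hX, hsupp₂ U X hX, mul_zero, add_zero]

/-- [folklore] **THE ROTATED REAL FAMILY HAS THE PAIR's COMPLEX-MODULUS PROFILE**: `‖(H₁ U X, H₂ U X)‖_ℂ ≤ e^{−κd(X)}·N` on
`scale X = j` ⇒ `|(cos φ•H₁ + sin φ•H₂) U X| ≤ e^{−κd(X)}·N` there (Cauchy–Schwarz, §1). -/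
theorem abs_rot_apply_le {H₁ H₂ : Bg → C.Dom → ℝ} {j : ℕ} {N : ℝ}
    (hb : ∀ (U : Bg) (X : C.Dom), C.scale X = j → ‖(⟨H₁ U X, H₂ U X⟩ : ℂ)‖ ≤ Real.exp (-(κ * C.d X)) * N) (φ : ℝ) :
    ∀ (U : Bg) (X : C.Dom), C.scale X = j →
      |(Real.cos φ • H₁ + Real.sin φ • H₂) U X| ≤ Real.exp (-(κ * C.d X)) * N := fun U X hX => by
  simp only [Pi.add_apply, Pi.smul_apply, smul_eq_mul]
  exact (abs_cos_mul_add_sin_mul_le φ (H₁ U X) (H₂ U X)).trans (hb U X hX)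

/-- **THE CHANNEL ON THE ROTATED REAL FAMILY**, per-slice form: for an admissible pair supported at the creation step `j ≤ k` with
profiles there, `T k s (cos φ•H₁ + sin φ•H₂) y = cos φ·T k s H₁ y + sin φ·T k s H₂ y` — ℝ-linearity of the channel on one-step slices
(`channel_add` + `channel_smul_atStep` of `NE9ChannelRealLinear`, i.e. additivity + the per-step size binder + Cauchy's functional
equation).  Printed TYPE behind the binders: [II] (1.23) p. 7 (linear in the old term), (1.36) p. 9.
[cite: Balaban1988RG2Cluster, (1.23) p.7, p.8 l.9-10 and (1.36) p.9] -/
theorem channel_rotate_atStep (hadd : ChannelAdditive Adm T) (hstep : ChannelSizeAtStepNN Adm T κ wt τ)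
    (hsub : ∀ H₁ ∈ Adm, ∀ H₂ ∈ Adm, H₁ - H₂ ∈ Adm) (hsmul : ∀ (c : ℝ), ∀ H ∈ Adm, c • H ∈ Adm)
    {H₁ H₂ : Bg → C.Dom → ℝ} (h₁ : H₁ ∈ Adm) (h₂ : H₂ ∈ Adm) {k j : ℕ} (hjk : j ≤ k) (s : ℕ → ℝ)
    (hsupp₁ : ∀ (U : Bg) (X : C.Dom), C.scale X ≠ j → H₁ U X = 0)
    (hsupp₂ : ∀ (U : Bg) (X : C.Dom), C.scale X ≠ j → H₂ U X = 0) {N₁ N₂ : ℝ} (hN₁ : 0 ≤ N₁) (hN₂ : 0 ≤ N₂)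
    (hb₁ : ∀ (U : Bg) (X : C.Dom), C.scale X = j → |H₁ U X| ≤ Real.exp (-(κ * C.d X)) * N₁)
    (hb₂ : ∀ (U : Bg) (X : C.Dom), C.scale X = j → |H₂ U X| ≤ Real.exp (-(κ * C.d X)) * N₂) (φ : ℝ) (y : ι) :
    T k s (Real.cos φ • H₁ + Real.sin φ • H₂) y = Real.cos φ * T k s H₁ y + Real.sin φ * T k s H₂ y := by
  rw [channel_add hadd hsub hsmul (hsmul _ H₁ h₁) (hsmul _ H₂ h₂) k s y,
    channel_smul_atStep hadd hstep hsmul h₁ hjk s hsupp₁ hN₁ hb₁ (Real.cos φ) y,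
    channel_smul_atStep hadd hstep hsmul h₂ hjk s hsupp₂ hN₂ hb₂ (Real.sin φ) y]

/-- **THE `√2`-FREE PER-SLICE BOUND OF THE COMPLEXIFIED CHANNEL FROM A COMPLEX-MODULUS PROFILE** (F-R4-3 removed): if the
admissible pair `(H₁, H₂)` is supported at the creation step `j ≤ k` and the complex family `H₁ + i·H₂` obeys
`‖(H₁ U X, H₂ U X)‖_ℂ ≤ e^{−κd(X)}·N` there, then `‖(T k s H₁ y, T k s H₂ y)‖_ℂ ≤ wt k y·(τ k j·N)` — `NE9ChannelRealLinear.
norm_channel_complex_le_atStep_of_complexBound` WITHOUT its factor `√2`.  Every rotated real part of the output is the channel of the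
rotated real family (`channel_rotate_atStep`), which is admissible, supported at `j`, and has profile `≤ e^{−κd}·N` (`abs_rot_apply_le`),
so the per-step size binder bounds it by `wt k y·(τ k j·N)`; §1 `norm_mk_le_of_forall_rotation` closes.  Needs, beyond `hstep`, the
channel's additivity `hadd` and the DISPLAYED closure of `Adm` under differences and real scalars (as p252383 §2–§3).
[cite: Balaban1988RG2Cluster, p.8 l.9-10 and (1.36) p.9] -/
theorem norm_channel_complex_le_atStep_of_complexBound_sharp (hadd : ChannelAdditive Adm T)
    (hstep : ChannelSizeAtStepNN Adm T κ wt τ)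
    (hsub : ∀ H₁ ∈ Adm, ∀ H₂ ∈ Adm, H₁ - H₂ ∈ Adm) (hsmul : ∀ (c : ℝ), ∀ H ∈ Adm, c • H ∈ Adm)
    {H₁ H₂ : Bg → C.Dom → ℝ} (h₁ : H₁ ∈ Adm) (h₂ : H₂ ∈ Adm) {k j : ℕ} (hjk : j ≤ k) (s : ℕ → ℝ)
    (hsupp₁ : ∀ (U : Bg) (X : C.Dom), C.scale X ≠ j → H₁ U X = 0)
    (hsupp₂ : ∀ (U : Bg) (X : C.Dom), C.scale X ≠ j → H₂ U X = 0) {N : ℝ} (hN : 0 ≤ N)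
    (hb : ∀ (U : Bg) (X : C.Dom), C.scale X = j → ‖(⟨H₁ U X, H₂ U X⟩ : ℂ)‖ ≤ Real.exp (-(κ * C.d X)) * N) (y : ι) :
    ‖(⟨T k s H₁ y, T k s H₂ y⟩ : ℂ)‖ ≤ wt k y * (τ k j * N) := by
  have hb₁ : ∀ (U : Bg) (X : C.Dom), C.scale X = j → |H₁ U X| ≤ Real.exp (-(κ * C.d X)) * N :=
    fun U X hX => (abs_re_im_le_of_norm_mk_le (hb U X hX)).1
  have hb₂ : ∀ (U : Bg) (X : C.Dom), C.scale X = j → |H₂ U X| ≤ Real.exp (-(κ * C.d X)) * N :=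
    fun U X hX => (abs_re_im_le_of_norm_mk_le (hb U X hX)).2
  refine norm_mk_le_of_forall_rotation fun φ => ?_
  have hrot := hstep k j hjk s (Real.cos φ • H₁ + Real.sin φ • H₂) (rot_mem hsub hsmul h₁ h₂ φ)
    (rot_supported hsupp₁ hsupp₂ φ) N hN (abs_rot_apply_le hb φ) y
  rw [channel_rotate_atStep hadd hstep hsub hsmul h₁ h₂ hjk s hsupp₁ hsupp₂ hN hN hb₁ hb₂ φ y] at hrot
  have h := (le_abs_self _).trans hrot
  linarith

end Channel

/-! ## §3 The `√2`-free entry bound of the reading -/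

section Entries

variable {C : Carriers} {Bg ι : Type} {κ : ℝ} {T : ℕ → (ℕ → ℝ) → (Bg → C.Dom → ℝ) → ι → ℝ} {wt : ℕ → ι → ℝ}
  {Adm : Set (Bg → C.Dom → ℝ)} {τ : ℕ → ℕ → ℝ}

/-- [folklore] THE COMPLEX-MODULUS PROFILE OF THE RESTRICTED PARTS of a slice-space element at its creation step:
`‖((reF κ G)↾j U X, (imF κ G)↾j U X)‖_ℂ ≤ e^{−κd(X)}·‖G‖` on `scale X = j` (`NE9SliceSpaceOfRecord.norm_mk_reF_imF_le`). -/
theorem norm_mk_restrictScale_reF_imF_le (κ : ℝ) (G : lp (fun _ : Bg × C.Dom => ℂ) ∞) (j : ℕ) :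
    ∀ (U : Bg) (X : C.Dom), C.scale X = j →
      ‖(⟨restrictScale j (reF κ G) U X, restrictScale j (imF κ G) U X⟩ : ℂ)‖ ≤ Real.exp (-(κ * C.d X)) * ‖G‖ :=
  fun U X hX => by
    rw [restrictScale_of_eq _ hX, restrictScale_of_eq _ hX]
    exact norm_mk_reF_imF_le κ G U X

/-- **THE `√2`-FREE ENTRY BOUND**: for a slice-space element `G` (parts admissible), `j ≤ m`, positive weights, the END of record's
binders `ChannelAdditive` + `AdmRestrict` + `ChannelSizeAtStepNN` and the displayed closure of `Adm` under differences and real scalars: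
`‖rdFun κ T wt m j s G y‖ ≤ τ m j·‖G‖` — p253328's `norm_rdFun_apply_le` without `√2`.
[cite: Balaban1988RG2Cluster, p.8 l.9-10 and (1.36) p.9] -/
theorem norm_rdFun_apply_le_sharp (hadd : ChannelAdditive Adm T) (hres : AdmRestrict Adm)
    (hstep : ChannelSizeAtStepNN Adm T κ wt τ)
    (hsub : ∀ H₁ ∈ Adm, ∀ H₂ ∈ Adm, H₁ - H₂ ∈ Adm) (hsmul : ∀ (c : ℝ), ∀ H ∈ Adm, c • H ∈ Adm)
    (hwt : ∀ m y, 0 < wt m y) {G : lp (fun _ : Bg × C.Dom => ℂ) ∞} (hre : reF κ G ∈ Adm) (him : imF κ G ∈ Adm)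
    {m j : ℕ} (hjm : j ≤ m) (s : ℕ → ℝ) (y : ι) : ‖rdFun κ T wt m j s G y‖ ≤ τ m j * ‖G‖ := by
  have hw := hwt m y
  have key := norm_channel_complex_le_atStep_of_complexBound_sharp hadd hstep hsub hsmul (hres.1 _ hre j) (hres.1 _ him j)
    hjm s (restrictScale_supported j _) (restrictScale_supported j _) (norm_nonneg G)
    (norm_mk_restrictScale_reF_imF_le κ G j) y
  rw [rdFun_apply, norm_mul, norm_inv, Complex.norm_real, Real.norm_of_nonneg hw.le]
  calc (wt m y)⁻¹ * ‖(⟨T m s (restrictScale j (reF κ G)) y, T m s (restrictScale j (imF κ G)) y⟩ : ℂ)‖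
      ≤ (wt m y)⁻¹ * (wt m y * (τ m j * ‖G‖)) := mul_le_mul_of_nonneg_left key (inv_nonneg.mpr hw.le)
    _ = τ m j * ‖G‖ := by field_simp

end Entries

/-! ## §4 The `√2`-free operator norms: `‖Rd m j s‖ ≤ τ m j`, and K2♭'s `hRd` with `τ₀ := τ̄` -/

section CLM

variable {C : Carriers} {Bg ι : Type} {κ : ℝ} {T : ℕ → (ℕ → ℝ) → (Bg → C.Dom → ℝ) → ι → ℝ} {wt : ℕ → ι → ℝ}
  {Adm : Set (Bg → C.Dom → ℝ)} {τ : ℕ → ℕ → ℝ}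

/-- **`‖Rd m j s‖ ≤ τ m j`** (p253328's `norm_Rd_le` without `√2`; same data `Rd`). [cite: Balaban1988RG2Cluster, p.8 l.9-10 and (1.36) p.9] -/
theorem norm_Rd_le_sharp {hadd : ChannelAdditive Adm T} {hres : AdmRestrict Adm} {hstep : ChannelSizeAtStepNN Adm T κ wt τ}
    {hsub : ∀ H₁ ∈ Adm, ∀ H₂ ∈ Adm, H₁ - H₂ ∈ Adm} {hsmul : ∀ (c : ℝ), ∀ H ∈ Adm, c • H ∈ Adm} {hne : Adm.Nonempty}
    {hwt : ∀ m y, 0 < wt m y} {m j : ℕ} {hjm : j ≤ m} {hτ : 0 ≤ τ m j} {s : ℕ → ℝ} :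
    ‖Rd κ T wt Adm τ hadd hres hstep hsub hsmul hne hwt m j hjm hτ s‖ ≤ τ m j := by
  refine ContinuousLinearMap.opNorm_le_bound _ hτ fun G => ?_
  refine lp.norm_le_of_forall_le (mul_nonneg hτ (norm_nonneg _)) fun y => ?_
  rw [Rd_apply_coe]
  have h := norm_rdFun_apply_le_sharp hadd hres hstep hsub hsmul hwt G.2.1 G.2.2 hjm s y
  simpa only [Submodule.coe_norm] using h

/-- **`‖RdOf m j s‖ ≤ τ m j` for `j ≤ m`** (and `RdOf m j s = 0` for `j > m`). [folklore] -/
theorem norm_RdOf_le_sharp {hadd : ChannelAdditive Adm T} {hres : AdmRestrict Adm} {hstep : ChannelSizeAtStepNN Adm T κ wt τ}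
    {hsub : ∀ H₁ ∈ Adm, ∀ H₂ ∈ Adm, H₁ - H₂ ∈ Adm} {hsmul : ∀ (c : ℝ), ∀ H ∈ Adm, c • H ∈ Adm} {hne : Adm.Nonempty}
    {hwt : ∀ m y, 0 < wt m y} {hτ : ∀ m j, j ≤ m → 0 ≤ τ m j} {m j : ℕ} (hjm : j ≤ m) (s : ℕ → ℝ) :
    ‖RdOf κ T wt Adm τ hadd hres hstep hsub hsmul hne hwt hτ m j s‖ ≤ τ m j := by
  rw [RdOf_of_le hjm]
  exact norm_Rd_le_sharp

/-- **K2♭'s BINDER (B2) FROM THE RECORD's GEOMETRIC WEIGHTS, `√2`-FREE**: `τ m j ≤ τ̄·ω^{m−j}` for `j ≤ m` ⇒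
`‖RdOf (j+n) j s‖ ≤ τ̄·ωⁿ` — `hRd` with `τ₀ := τ̄` (p253328's `norm_RdOf_le_geometric` without `√2`).
[cite: Balaban1988RG2Cluster, p.8 l.9-10 and (1.36) p.9] -/
theorem norm_RdOf_le_geometric_sharp {hadd : ChannelAdditive Adm T} {hres : AdmRestrict Adm}
    {hstep : ChannelSizeAtStepNN Adm T κ wt τ} {hsub : ∀ H₁ ∈ Adm, ∀ H₂ ∈ Adm, H₁ - H₂ ∈ Adm}
    {hsmul : ∀ (c : ℝ), ∀ H ∈ Adm, c • H ∈ Adm} {hne : Adm.Nonempty} {hwt : ∀ m y, 0 < wt m y}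
    {hτ : ∀ m j, j ≤ m → 0 ≤ τ m j} {τbar ω : ℝ} (hgeom : ∀ m j, j ≤ m → τ m j ≤ τbar * ω ^ (m - j)) (j n : ℕ)
    (s : ℕ → ℝ) : ‖RdOf κ T wt Adm τ hadd hres hstep hsub hsmul hne hwt hτ (j + n) j s‖ ≤ τbar * ω ^ n := by
  refine (norm_RdOf_le_sharp (Nat.le_add_right j n) s).trans ?_
  have h := hgeom (j + n) j (Nat.le_add_right j n)
  rwa [Nat.add_sub_cancel_left] at h

/-- **K2♭'s (B2) ON THE AMBIENT SPACE, `√2`-FREE**: `‖RdAmb (j+n) j s‖ ≤ τ̄·ωⁿ` under the record's geometric weights (p253328's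
`norm_RdAmb_le_geometric` without `√2`; the Hahn–Banach extension keeps the norm bound, `norm_extCLM_le`).  Route R4's docking may
take `τ₀ := τ̄`. [cite: Balaban1988RG2Cluster, p.8 l.9-10 and (1.36) p.9] -/
theorem norm_RdAmb_le_geometric_sharp {hadd : ChannelAdditive Adm T} {hres : AdmRestrict Adm}
    {hstep : ChannelSizeAtStepNN Adm T κ wt τ} {hsub : ∀ H₁ ∈ Adm, ∀ H₂ ∈ Adm, H₁ - H₂ ∈ Adm}
    {hsmul : ∀ (c : ℝ), ∀ H ∈ Adm, c • H ∈ Adm} {hne : Adm.Nonempty} {hwt : ∀ m y, 0 < wt m y}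
    {hτ : ∀ m j, j ≤ m → 0 ≤ τ m j} {τbar ω : ℝ} (hgeom : ∀ m j, j ≤ m → τ m j ≤ τbar * ω ^ (m - j)) (j n : ℕ)
    (s : ℕ → ℝ) : ‖RdAmb (κ := κ) hadd hres hstep hsub hsmul hne hwt hτ (j + n) j s‖ ≤ τbar * ω ^ n :=
  (norm_extCLM_le _ _).trans (norm_RdOf_le_geometric_sharp hgeom j n s)

end CLM

/-! ## §5 Sharpness of the parts-wise `√2` (so only the complex-modulus-profile form improves) -/

/-- [folklore] The parts-wise bound `norm_mk_le_sqrt_two_mul` of p252383 is ATTAINED at `u = v = M = 1`: `‖1 + i‖ = √2`. -/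
example : ‖(⟨1, 1⟩ : ℂ)‖ = Real.sqrt 2 * 1 := by
  rw [mul_one]
  have h : ‖(⟨1, 1⟩ : ℂ)‖ ^ 2 = 2 := by
    rw [← Complex.normSq_eq_norm_sq]; norm_num [Complex.normSq_apply]
  have hnn : 0 ≤ ‖(⟨1, 1⟩ : ℂ)‖ := norm_nonneg _
  rw [← Real.sqrt_sq hnn, h]

/-- [folklore] …whereas the rotation lemma recovers `‖1 + i‖ ≤ √2` with constant `1` from the rotated real parts
`cos φ + sin φ ≤ √2`. -/
example : ‖(⟨1, 1⟩ : ℂ)‖ ≤ Real.sqrt 2 := by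
  refine norm_mk_le_of_forall_rotation fun φ => ?_
  have h := abs_cos_mul_add_sin_mul_le φ 1 1
  rw [mul_one, mul_one] at h
  have h2 : ‖(⟨1, 1⟩ : ℂ)‖ ≤ Real.sqrt 2 * 1 :=
    norm_mk_le_sqrt_two_mul (by norm_num) (by norm_num)
  have h3 := (le_abs_self _).trans h
  linarith

end Summit.QuantumFields.BalabanUV.T4Continuum.NE9ChannelReadingSharp

end
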